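import Literature.AlgebraicGeometry.ModuliOfAbelianVarieties.SiegelFamilyHumbertDiscriminantForm
import Literature.NumberTheory.Automorphic.QuaternionAlgebraSplitting
import Mathlib.LinearAlgebra.Dimension.OrzechProperty
import HarnessLib

/-!
# The quaternion algebra `ℚ(α, β) = ℚ ⊕ ℚα ⊕ ℚβ ⊕ ℚαβ ≅ (Δ(α), −det S_Δ)_ℚ` of a pair of singular relations
# (Runge 1999, §6 Lemma 8 / Theorem 7)

Layer `Literature/AlgebraicGeometry/ModuliOfAbelianVarieties`, namespace
`Literature.AlgebraicGeometry.ModuliOfAbelianVarieties.SiegelModuli`; lane `lit-hodgefound` (Track 2 foundations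
library, Layer A4), seat `lit-hodgefound-skel-4`, row **A4-66**, FILE 2. Sequel of FILE 1
(`SiegelFamilyHumbertDiscriminantForm`: Runge's Lemma 8 `αβ + βα = t(α)β + t(β)α − n(α,β)`, the discriminant form
`Δ(q, q′) = humbertPolar q q′`, the commutator `γ = humbertComm q q′` with `4γ² = (Δ(q,q′)² − Δ(q)Δ(q′))·1`, the square
root `α₀ = humbertSqrt q = 2R₀ − b` with `α₀² = Δ(q)·1`, `α₀γ = −γα₀`), of row A4-64 FILE 5
(`SiegelFamilyHumbertQuadraticOrder`: `R₀² = −(ac+de)·1 + b·R₀` over `ℚ`) and of the tree's quaternion-algebra toolkit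
(`Literature/NumberTheory/Automorphic/QuaternionAlgebraSplitting`: Mathlib's `ℍ[K,a,b]` is central simple for
`ab ≠ 0`, and `ℍ[F,a,b] ≅ M₂(F) ⟺ b = x² − ay²`). PURE ALGEBRA over `ℚ`: the sub-`ℚ`-algebra of `M₄(ℚ)` generated by
the rational representations `R₀(q)`, `R₀(q′)` of the symmetric endomorphisms of two singular relations `q, q′ ∈ ℤ⁵`.

## Source followed, verbatim (B. Runge, *Endomorphism rings of abelian surfaces and projective models of their moduli
## spaces*, Tohoku Math. J. 51 (1999), held text `paper:doi-10-2748-tmj-1178224764`, §6 pp. 294–295 = p0012–p0013)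

* **LEMMA 8.** "Let `α` and `β` be Rosati invariant elements of `M₄(ℚ)`. Then it holds that
  `αβ + βα = t(α)β + t(β)α − n(α, β)`. In particular, if `ℚ(α)` and `ℚ(β)` are real quadratic fields such that
  `ℚ(α) ≠ ℚ(β)`, then `ℚ(α, β)` is a quaternion algebra."
* **THEOREM 7.** "Any QCM-order can be written as `R = ℤ ⊕ ℤα ⊕ ℤβ ⊕ ℤαβ`, where `α` and `β` are primitive Rosati
  invariant elements of positive discriminant `Δ(α)`, `Δ(β)`, such that the discriminant matrix
  `S_Δ = (Δ(α) Δ(α, β); Δ(α, β) Δ(β))` is positive definite. The discriminant of `R` is `d(R) = det(S_Δ)/4`. PROOF. It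
  follows from Theorem 1 that `R ⊗ ℚ = ℚ ⊕ ℚα ⊕ ℚβ ⊕ ℚαβ`, where `α` and `β` are Rosati invariant elements of positive
  discriminant `Δ(α)`, `Δ(β)`. Moreover, up to multiplication by a non-zero rational number, the element `γ = αβ − βα` is a
  unique element with `γ̄ = −γ`. The algebra `R ⊗ ℚ` is admissible if and only if `γ² = −n(γ) = (Δ(α, β)² − Δ(α)Δ(β))/4`
  is a negative number."

## What is proved (for `q, q′ ∈ ℤ⁵`, `α = R₀(q)`, `β = R₀(q′)` over `ℚ`, `Δ = Δ(q)`, `Δ′ = Δ(q′)`, `B = Δ(q, q′)`,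
## `det S_Δ = ΔΔ′ − B²`; definitions with bodies and theorems, NO named fact, net debt 0)

* §1 `humbertPairAlg q q′ = ℚ(α, β) := Algebra.adjoin ℚ {R₀(q), R₀(q′)} ⊆ M₄(ℚ)` (Runge's `ℚ(α, β)`; it contains every
  `X(m, q)`, `X(n, q′)`), and **`humbertPairAlg_toSubmodule_eq_span`: `ℚ(α, β) = ℚ·1 + ℚα + ℚβ + ℚαβ`** (the four elements
  SPAN, unconditionally — multiplicative closure of the span by Lemma 8 and `R₀² = bR₀ − (ac+de)`).
* §2 **`humbertQuatBasis q q′`: a `QuaternionAlgebra.Basis` of `M₄(ℚ)` with parameters `(c₁, c₂, c₃) = (Δ, 0, B² − ΔΔ′)`**,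
  `i = α₀ = 2α − b`, `j = 2γ = 2(αβ − βα)`, `k = ij` (`i² = Δ`, `j² = B² − ΔΔ′ = −det S_Δ`, `ij = −ji`), whence the algebra map
  `ℍ[ℚ, Δ, B² − ΔΔ′] →ₐ[ℚ] M₄(ℚ)` (`QuaternionAlgebra.Basis.liftHom`) with **`range_liftHom_humbertQuatBasis`**: its image
  is `ℚ(α, β)` (for `Δ ≠ 0`).
* §3 for `Δ ≠ 0` and `det S_Δ ≠ 0`: **`humbertQuatBasis_liftHom_injective`** (a non-zero algebra map out of the central
  simple `ℍ[ℚ,Δ,B²−ΔΔ′]`), **`humbertPairAlgEquiv : ℍ[ℚ, Δ, B² − ΔΔ′] ≃ₐ[ℚ] ℚ(α, β)`** — "`ℚ(α, β)` is a quaternion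
  algebra": **`isQuaternionAlgebra_humbertPairAlg`** (central, simple, `dim_ℚ = 4`: the tree's `IsQuaternionAlgebra`),
  `finrank_humbertPairAlg` (`= 4`), **`linearIndependent_one_humbertRatRep_pair`** (`1, α, β, αβ` are linearly
  independent: "`R ⊗ ℚ = ℚ ⊕ ℚα ⊕ ℚβ ⊕ ℚαβ`"), `humbertRatRep_map_mul_ne` / `exists_mul_ne_of_humbertPairAlg` (`det S_Δ ≠ 0 ⟹
  αβ ≠ βα`: `ℚ(α, β)` is non-commutative).
* §1 also records Lemma 8 over `ℚ` (`humbertRatRep_map_mul_add_mul`, `humbertRatRep_map_mul_swap`), the membership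
  form `exists_eq_comb_of_mem_humbertPairAlg` and `finrank_humbertPairAlg_le_four` (`dim_ℚ ℚ(α, β) ≤ 4` always).
* §4 admissibility sign: **`nonempty_algEquiv_real_matrix_of_humbertInvariant_pos`** — for `Δ(q) > 0` (a relation
  with a solution in `𝔥₂`) and any `c ≠ 0` the real algebra `ℍ[ℝ, Δ, c]` is `≅ M₂(ℝ)`: the quaternion algebra
  `(Δ, −det S_Δ)_ℚ` is INDEFINITE (split at the real place), whatever the sign of `det S_Δ`; Runge's admissibility
  condition "`γ² < 0`" is `det S_Δ > 0`, i.e. `S_Δ` definite (FILE 3: automatic at a point of `𝔥₂`).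

## Scope / deviations

* Runge's hypothesis in Lemma 8 ("`ℚ(α) ≠ ℚ(β)` real quadratic fields") is replaced by the hypothesis actually used in
  his Theorem 7, `det S_Δ ≠ 0` together with `Δ(α) ≠ 0` (for abstract Rosati matrices `det S_Δ = 0` with `ℚ(α) ≠ ℚ(β)`
  can occur and then `γ` is a non-zero nilpotent, so `ℚ(α, β)` is not semisimple; at points of `𝔥₂` both hypotheses
  hold, FILE 3). The order-theoretic statements of Theorem 7 (`R = ℤ ⊕ ℤα ⊕ ℤβ ⊕ ℤαβ` for a QCM-ORDER, `d(R) = det S_Δ/4`)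
  and the uniqueness of `γ` up to `ℚ^×` are NOT formalised.
* The identification with Mathlib's `ℍ[ℚ, c₁, c₂, c₃]` uses the trace-free generators `i = 2α − t(α)`, `j = 2γ`; in
  Runge's normalisation `γ² = −det S_Δ/4`, here `(2γ)² = −det S_Δ`.

## References

* [Runge1999EndomorphismRingsAbelianSurfaces] B. Runge, *Endomorphism rings of abelian surfaces and projective models of
  their moduli spaces*, Tohoku Math. J. 51 (1999) 283–303, §6 Lemma 8, Thm. 7 (pp. 294–295).
* [VignerasLNM800] M.-F. Vignéras, *Arithmétique des algèbres de quaternions*, LNM 800 (1980), Ch. I §1–§2 (quaternion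
  algebras `{a, b}` are central simple; `≅ M₂(F)` iff `b ∈ n(F(√a))`) — through the tree's `QuaternionAlgebraSplitting`.
-/

noncomputable section

open Matrix Module Function
open scoped Quaternion

namespace Literature.AlgebraicGeometry.ModuliOfAbelianVarieties

namespace SiegelModuli

open Literature.Geometry.Kaehler Literature.Geometry.Kaehler.ComplexTorus
open Literature.NumberTheory.Automorphic

/-! ### Casting the integer identities of FILE 1 to `ℚ` -/

section Cast

variable {ι : Type*}

/-- Plumbing (`castQ_mul`): casting / spanning-set bookkeeping for this file. [folklore] -/
private theorem castQ_mul [Fintype ι] (A B : Matrix ι ι ℤ) :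
    (A * B).map (Int.cast : ℤ → ℚ) = A.map (Int.cast : ℤ → ℚ) * B.map (Int.cast : ℤ → ℚ) := by
  have h := Matrix.map_mul (L := A) (M := B) (f := Int.castRingHom ℚ)
  simpa only [Int.coe_castRingHom] using h

/-- Plumbing (`castQ_add`): casting / spanning-set bookkeeping for this file. [folklore] -/
private theorem castQ_add (A B : Matrix ι ι ℤ) :
    (A + B).map (Int.cast : ℤ → ℚ) = A.map (Int.cast : ℤ → ℚ) + B.map (Int.cast : ℤ → ℚ) :=
  Matrix.map_add Int.cast (Int.cast_add) A B

/-- Plumbing (`castQ_sub`): casting / spanning-set bookkeeping for this file. [folklore] -/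
private theorem castQ_sub (A B : Matrix ι ι ℤ) :
    (A - B).map (Int.cast : ℤ → ℚ) = A.map (Int.cast : ℤ → ℚ) - B.map (Int.cast : ℤ → ℚ) :=
  Matrix.map_sub Int.cast (Int.cast_sub) A B

/-- Plumbing (`castQ_neg`): casting / spanning-set bookkeeping for this file. [folklore] -/
private theorem castQ_neg (A : Matrix ι ι ℤ) : (-A).map (Int.cast : ℤ → ℚ) = -A.map (Int.cast : ℤ → ℚ) :=
  Matrix.map_neg Int.cast (Int.cast_neg) A

/-- Plumbing (`castQ_smul`): casting / spanning-set bookkeeping for this file. [folklore] -/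
private theorem castQ_smul (c : ℤ) (A : Matrix ι ι ℤ) :
    (c • A).map (Int.cast : ℤ → ℚ) = (c : ℚ) • A.map (Int.cast : ℤ → ℚ) := by
  ext i j; simp only [Matrix.map_apply, Matrix.smul_apply, smul_eq_mul, Int.cast_mul]

/-- Plumbing (`castQ_one`): casting / spanning-set bookkeeping for this file. [folklore] -/
private theorem castQ_one [DecidableEq ι] : (1 : Matrix ι ι ℤ).map (Int.cast : ℤ → ℚ) = 1 :=
  Matrix.map_one Int.cast Int.cast_zero Int.cast_one

/-- Plumbing (`castQ_zero`): casting / spanning-set bookkeeping for this file. [folklore] -/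
private theorem castQ_zero : (0 : Matrix ι ι ℤ).map (Int.cast : ℤ → ℚ) = 0 :=
  Matrix.map_zero Int.cast Int.cast_zero

/-- Plumbing (`castQ_injective`): casting / spanning-set bookkeeping for this file. [folklore] -/
private theorem castQ_injective : Function.Injective (fun A : Matrix ι ι ℤ ↦ A.map (Int.cast : ℤ → ℚ)) :=
  fun A B h ↦ Matrix.ext fun i j ↦ by
    have := congr_fun (congr_fun h i) j
    simpa using this

end Cast

section PairAlgebra

variable (q q' : Fin 5 → ℤ)

/-- `α = R₀(q)` over `ℚ`. -/
local notation "α" => Matrix.map (humbertRatRep q) (Int.cast : ℤ → ℚ)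
/-- `β = R₀(q′)` over `ℚ`. -/
local notation "β" => Matrix.map (humbertRatRep q') (Int.cast : ℤ → ℚ)

/-! ## §1 Runge's `ℚ(α, β)` and its spanning set `1, α, β, αβ` -/

/-- **Runge's `ℚ(α, β)`: the sub-`ℚ`-algebra of `M₄(ℚ)` generated by the rational representations `α = R₀(q)`,
`β = R₀(q′)` of the symmetric endomorphisms of two singular relations** (it contains all the Rosati matrices
`X(m, q) = m·1 + R₀(q)`, `X(n, q′)`, so it is `ℚ(X(m,q), X(n,q′))` for any trace parameters).
[cite: Runge1999EndomorphismRingsAbelianSurfaces, §6 Lemma 8 (p. 295: "`ℚ(α, β)`")] -/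
def humbertPairAlg : Subalgebra ℚ (Matrix (Fin 2 ⊕ Fin 2) (Fin 2 ⊕ Fin 2) ℚ) :=
  Algebra.adjoin ℚ {Matrix.map (humbertRatRep q) (Int.cast : ℤ → ℚ), Matrix.map (humbertRatRep q') (Int.cast : ℤ → ℚ)}

/-- Unfolding of `humbertPairAlg`. [cite: Runge1999EndomorphismRingsAbelianSurfaces, §6 Lemma 8 (p. 295)] -/
theorem humbertPairAlg_def : humbertPairAlg q q' = Algebra.adjoin ℚ {α, β} := rfl

/-- `α ∈ ℚ(α, β)`. [cite: Runge1999EndomorphismRingsAbelianSurfaces, §6 Lemma 8 (p. 295)] -/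
theorem humbertRatRep_map_mem_humbertPairAlg_left : α ∈ humbertPairAlg q q' :=
  Algebra.subset_adjoin (Set.mem_insert _ _)

/-- `β ∈ ℚ(α, β)`. [cite: Runge1999EndomorphismRingsAbelianSurfaces, §6 Lemma 8 (p. 295)] -/
theorem humbertRatRep_map_mem_humbertPairAlg_right : β ∈ humbertPairAlg q q' :=
  Algebra.subset_adjoin (Set.mem_insert_of_mem _ (Set.mem_singleton _))

/-- `ℚ(α, β) = ℚ(β, α)`. [cite: Runge1999EndomorphismRingsAbelianSurfaces, §6 Lemma 8 (p. 295)] -/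
theorem humbertPairAlg_comm : humbertPairAlg q q' = humbertPairAlg q' q := by
  rw [humbertPairAlg, humbertPairAlg, Set.pair_comm]

/-- The Rosati matrices `X(m, q) = m·1 + R₀(q)` lie in `ℚ(α, β)`. [cite: Runge1999EndomorphismRingsAbelianSurfaces, §6 Lemma 8 (p. 295)] -/
theorem rosatiMatrix_map_mem_humbertPairAlg (m : ℤ) :
    (rosatiMatrix m q).map (Int.cast : ℤ → ℚ) ∈ humbertPairAlg q q' := by
  rw [rosatiMatrix_eq_smul_one_add, castQ_add, castQ_smul, castQ_one]
  exact add_mem (Subalgebra.smul_mem _ (one_mem _) _) (humbertRatRep_map_mem_humbertPairAlg_left q q')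

/-- **Lemma 8 over `ℚ`: `αβ + βα = b·β + b′·α − N(q, q′)·1`** (the relation parts; `N = ac′ + a′c + de′ + d′e`).
[cite: Runge1999EndomorphismRingsAbelianSurfaces, §6 Lemma 8 (p. 295)] -/
theorem humbertRatRep_map_mul_add_mul :
    α * β + β * α = (q 1 : ℚ) • β + (q' 1 : ℚ) • α - (humbertNormPolar q q' : ℚ) • (1 : Matrix _ _ ℚ) := by
  have h := congrArg (fun A : Matrix (Fin 2 ⊕ Fin 2) (Fin 2 ⊕ Fin 2) ℤ ↦ A.map (Int.cast : ℤ → ℚ))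
    (SiegelModuli.humbertRatRep_mul_add_mul q q')
  simp only [castQ_add, castQ_sub, castQ_mul, castQ_smul, castQ_one] at h
  exact h

/-- `βα` in the spanning set: `βα = −αβ + bβ + b′α − N·1`. [cite: Runge1999EndomorphismRingsAbelianSurfaces, §6 Lemma 8 (p. 295)] -/
theorem humbertRatRep_map_mul_swap :
    β * α = -(α * β) + (q 1 : ℚ) • β + (q' 1 : ℚ) • α - (humbertNormPolar q q' : ℚ) • (1 : Matrix _ _ ℚ) := by
  rw [← sub_eq_iff_eq_add'.2 (humbertRatRep_map_mul_add_mul q q').symm]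
  abel

/-- The spanning family `(1, α, β, αβ)` of `ℚ(α, β)`. [folklore] -/
private def spanFam : Fin 4 → Matrix (Fin 2 ⊕ Fin 2) (Fin 2 ⊕ Fin 2) ℚ := ![1, α, β, α * β]

/-- Plumbing (`mem_span_spanFam`): casting / spanning-set bookkeeping for this file. [folklore] -/
private theorem mem_span_spanFam (i : Fin 4) : spanFam q q' i ∈ Submodule.span ℚ (Set.range (spanFam q q')) :=
  Submodule.subset_span ⟨i, rfl⟩

/-- A linear combination `c₀·1 + c₁α + c₂β + c₃αβ` lies in the span. [folklore] -/
private theorem comb_mem_span (c₀ c₁ c₂ c₃ : ℚ) :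
    c₀ • (1 : Matrix (Fin 2 ⊕ Fin 2) (Fin 2 ⊕ Fin 2) ℚ) + c₁ • α + c₂ • β + c₃ • (α * β) ∈
      Submodule.span ℚ (Set.range (spanFam q q')) :=
  add_mem (add_mem (add_mem (Submodule.smul_mem _ _ (mem_span_spanFam q q' 0))
    (Submodule.smul_mem _ _ (mem_span_spanFam q q' 1))) (Submodule.smul_mem _ _ (mem_span_spanFam q q' 2)))
    (Submodule.smul_mem _ _ (mem_span_spanFam q q' 3))

/-- Left multiplication by `α` preserves the span of `1, α, β, αβ` (uses `α² = bα − (ac+de)·1`). [folklore] -/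
private theorem mul_left_mem_span_left {y : Matrix (Fin 2 ⊕ Fin 2) (Fin 2 ⊕ Fin 2) ℚ}
    (hy : y ∈ Submodule.span ℚ (Set.range (spanFam q q'))) : α * y ∈ Submodule.span ℚ (Set.range (spanFam q q')) := by
  induction hy using Submodule.span_induction with
  | mem x hx =>
    obtain ⟨i, rfl⟩ := hx
    have hsq := humbertRatRep_map_mul_self q
    fin_cases i
    · -- `α·1 = α`
      simpa [spanFam] using mem_span_spanFam q q' 1
    · -- `α·α = bα − n·1`
      have : α * α = ((-humbertNormTerm q : ℤ) : ℚ) • (1 : Matrix (Fin 2 ⊕ Fin 2) (Fin 2 ⊕ Fin 2) ℚ) +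
          ((q 1 : ℤ) : ℚ) • α + (0 : ℚ) • β + (0 : ℚ) • (α * β) := by
        rw [hsq, zero_smul, zero_smul, add_zero, add_zero]
      simp only [spanFam, Fin.mk_one, Matrix.cons_val_one, Matrix.cons_val_zero]
      rw [this]; exact comb_mem_span q q' _ _ _ _
    · -- `α·β`
      simpa [spanFam] using mem_span_spanFam q q' 3
    · -- `α·(αβ) = (α²)β = b αβ − n β`
      have : α * (α * β) = (0 : ℚ) • (1 : Matrix (Fin 2 ⊕ Fin 2) (Fin 2 ⊕ Fin 2) ℚ) + (0 : ℚ) • α +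
          ((-humbertNormTerm q : ℤ) : ℚ) • β + ((q 1 : ℤ) : ℚ) • (α * β) := by
        rw [← mul_assoc, hsq, add_mul, smul_mul_assoc, smul_mul_assoc, one_mul]
        module
      simp only [spanFam]
      rw [show (![1, α, β, α * β] : Fin 4 → _) ⟨3, by norm_num⟩ = α * β from rfl, this]
      exact comb_mem_span q q' _ _ _ _
  | zero => rw [mul_zero]; exact zero_mem _
  | add x y _ _ hx hy => rw [mul_add]; exact add_mem hx hy
  | smul c x _ hx => rw [mul_smul_comm]; exact Submodule.smul_mem _ _ hx

/-- Left multiplication by `β` preserves the span of `1, α, β, αβ` (uses Lemma 8 and `β² = b′β − (a′c′+d′e′)·1`). [folklore] -/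
private theorem mul_left_mem_span_right {y : Matrix (Fin 2 ⊕ Fin 2) (Fin 2 ⊕ Fin 2) ℚ}
    (hy : y ∈ Submodule.span ℚ (Set.range (spanFam q q'))) : β * y ∈ Submodule.span ℚ (Set.range (spanFam q q')) := by
  induction hy using Submodule.span_induction with
  | mem x hx =>
    obtain ⟨i, rfl⟩ := hx
    have hsq' := humbertRatRep_map_mul_self q'
    have hsw := humbertRatRep_map_mul_swap q q'
    fin_cases i
    · -- `β·1 = β`
      simpa [spanFam] using mem_span_spanFam q q' 2
    · -- `β·α = −αβ + bβ + b′α − N·1`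
      have : β * α = (-(humbertNormPolar q q' : ℚ)) • (1 : Matrix (Fin 2 ⊕ Fin 2) (Fin 2 ⊕ Fin 2) ℚ) +
          (q' 1 : ℚ) • α + (q 1 : ℚ) • β + (-1 : ℚ) • (α * β) := by
        rw [hsw]; module
      simp only [spanFam, Fin.mk_one, Matrix.cons_val_one, Matrix.cons_val_zero]
      rw [this]; exact comb_mem_span q q' _ _ _ _
    · -- `β·β = b′β − n′·1`
      have : β * β = ((-humbertNormTerm q' : ℤ) : ℚ) • (1 : Matrix (Fin 2 ⊕ Fin 2) (Fin 2 ⊕ Fin 2) ℚ) +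
          (0 : ℚ) • α + ((q' 1 : ℤ) : ℚ) • β + (0 : ℚ) • (α * β) := by
        rw [hsq', zero_smul, zero_smul, add_zero, add_zero]
      simp only [spanFam]
      rw [show (![1, α, β, α * β] : Fin 4 → _) ⟨2, by norm_num⟩ = β from rfl, this]
      exact comb_mem_span q q' _ _ _ _
    · -- `β·(αβ) = (βα)β = n′α + (bb′ − N)β − bn′·1`
      have : β * (α * β) = (-((q 1 : ℚ) * (humbertNormTerm q' : ℚ))) • (1 : Matrix (Fin 2 ⊕ Fin 2) (Fin 2 ⊕ Fin 2) ℚ) +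
          (humbertNormTerm q' : ℚ) • α + ((q 1 : ℚ) * (q' 1 : ℚ) - (humbertNormPolar q q' : ℚ)) • β +
          (0 : ℚ) • (α * β) := by
        rw [← mul_assoc, hsw]
        simp only [add_mul, sub_mul, neg_mul, smul_mul_assoc, one_mul, mul_assoc]
        rw [hsq']
        simp only [Int.cast_neg, mul_add, mul_smul_comm, mul_one, smul_add, smul_smul]
        module
      simp only [spanFam]
      rw [show (![1, α, β, α * β] : Fin 4 → _) ⟨3, by norm_num⟩ = α * β from rfl, this]
      exact comb_mem_span q q' _ _ _ _
  | zero => rw [mul_zero]; exact zero_mem _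
  | add x y _ _ hx hy => rw [mul_add]; exact add_mem hx hy
  | smul c x _ hx => rw [mul_smul_comm]; exact Submodule.smul_mem _ _ hx

/-- The span of `1, α, β, αβ` is closed under multiplication. [folklore] -/
private theorem mul_mem_span {x y : Matrix (Fin 2 ⊕ Fin 2) (Fin 2 ⊕ Fin 2) ℚ}
    (hx : x ∈ Submodule.span ℚ (Set.range (spanFam q q'))) (hy : y ∈ Submodule.span ℚ (Set.range (spanFam q q'))) :
    x * y ∈ Submodule.span ℚ (Set.range (spanFam q q')) := by
  induction hx using Submodule.span_induction with
  | mem x hx =>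
    obtain ⟨i, rfl⟩ := hx
    fin_cases i
    · simpa [spanFam] using hy
    · simpa [spanFam] using mul_left_mem_span_left q q' hy
    · simpa [spanFam] using mul_left_mem_span_right q q' hy
    · simp only [spanFam]
      rw [show (![1, α, β, α * β] : Fin 4 → _) ⟨3, by norm_num⟩ = α * β from rfl, mul_assoc]
      exact mul_left_mem_span_left q q' (mul_left_mem_span_right q q' hy)
  | zero => rw [zero_mul]; exact zero_mem _
  | add x₁ x₂ _ _ h₁ h₂ => rw [add_mul]; exact add_mem h₁ h₂
  | smul c x _ hx => rw [smul_mul_assoc]; exact Submodule.smul_mem _ _ hx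

/-- **"`R ⊗ ℚ = ℚ ⊕ ℚα ⊕ ℚβ ⊕ ℚαβ`", spanning half (unconditionally): `ℚ(α, β)` is the `ℚ`-span of `1, α, β, αβ`**
— the span is a subalgebra by Lemma 8 (`βα = −αβ + bβ + b′α − N`) and the quadratic relations `α² = bα − (ac+de)`,
`β² = b′β − (a′c′+d′e′)`. [cite: Runge1999EndomorphismRingsAbelianSurfaces, §6 Thm. 7, proof (p. 295: "`R ⊗ ℚ = ℚ ⊕ ℚα ⊕ ℚβ ⊕ ℚαβ`")] -/
theorem humbertPairAlg_toSubmodule_eq_span :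
    Subalgebra.toSubmodule (humbertPairAlg q q') = Submodule.span ℚ {1, α, β, α * β} := by
  have hrange : Set.range (spanFam q q') = {1, α, β, α * β} := by
    ext x
    simp only [spanFam, Set.mem_range, Set.mem_insert_iff, Set.mem_singleton_iff]
    constructor
    · rintro ⟨i, rfl⟩; fin_cases i <;> simp
    · rintro (rfl | rfl | rfl | rfl)
      · exact ⟨0, rfl⟩
      · exact ⟨1, rfl⟩
      · exact ⟨2, rfl⟩
      · exact ⟨3, rfl⟩
  rw [← hrange]
  -- the span is a subalgebra containing `α`, `β`
  let S : Subalgebra ℚ (Matrix (Fin 2 ⊕ Fin 2) (Fin 2 ⊕ Fin 2) ℚ) :=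
    (Submodule.span ℚ (Set.range (spanFam q q'))).toSubalgebra (mem_span_spanFam q q' 0)
      (fun x y hx hy ↦ mul_mem_span q q' hx hy)
  apply le_antisymm
  · have hle : humbertPairAlg q q' ≤ S := by
      rw [humbertPairAlg, Algebra.adjoin_le_iff]
      rintro x (rfl | rfl)
      · exact mem_span_spanFam q q' 1
      · exact mem_span_spanFam q q' 2
    exact fun x hx ↦ hle hx
  · rw [Submodule.span_le]
    rintro x ⟨i, rfl⟩
    fin_cases i
    · exact one_mem (humbertPairAlg q q')
    · exact humbertRatRep_map_mem_humbertPairAlg_left q q'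
    · exact humbertRatRep_map_mem_humbertPairAlg_right q q'
    · exact (humbertPairAlg q q').mul_mem (humbertRatRep_map_mem_humbertPairAlg_left q q')
        (humbertRatRep_map_mem_humbertPairAlg_right q q')

/-- Membership form: every element of `ℚ(α, β)` is `c₀·1 + c₁α + c₂β + c₃αβ`.
[cite: Runge1999EndomorphismRingsAbelianSurfaces, §6 Thm. 7, proof (p. 295)] -/
theorem exists_eq_comb_of_mem_humbertPairAlg {x : Matrix (Fin 2 ⊕ Fin 2) (Fin 2 ⊕ Fin 2) ℚ}
    (hx : x ∈ humbertPairAlg q q') :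
    ∃ c₀ c₁ c₂ c₃ : ℚ, x = c₀ • (1 : Matrix _ _ ℚ) + c₁ • α + c₂ • β + c₃ • (α * β) := by
  have hx' : x ∈ Subalgebra.toSubmodule (humbertPairAlg q q') := hx
  rw [humbertPairAlg_toSubmodule_eq_span] at hx'
  rw [show ({1, α, β, α * β} : Set (Matrix (Fin 2 ⊕ Fin 2) (Fin 2 ⊕ Fin 2) ℚ)) =
      Set.range (spanFam q q') by
    ext y; simp only [spanFam, Set.mem_range, Set.mem_insert_iff, Set.mem_singleton_iff]
    constructor
    · rintro (rfl | rfl | rfl | rfl)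
      · exact ⟨0, rfl⟩
      · exact ⟨1, rfl⟩
      · exact ⟨2, rfl⟩
      · exact ⟨3, rfl⟩
    · rintro ⟨i, rfl⟩; fin_cases i <;> simp,
    Submodule.mem_span_range_iff_exists_fun] at hx'
  obtain ⟨c, hc⟩ := hx'
  refine ⟨c 0, c 1, c 2, c 3, ?_⟩
  rw [← hc, Fin.sum_univ_four]
  rfl

/-- `dim_ℚ ℚ(α, β) ≤ 4`, always. [cite: Runge1999EndomorphismRingsAbelianSurfaces, §6 Thm. 7, proof (p. 295)] -/
theorem finrank_humbertPairAlg_le_four : finrank ℚ (humbertPairAlg q q') ≤ 4 := by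
  rw [← Subalgebra.finrank_toSubmodule, humbertPairAlg_toSubmodule_eq_span]
  calc finrank ℚ (Submodule.span ℚ ({1, α, β, α * β} : Set (Matrix (Fin 2 ⊕ Fin 2) (Fin 2 ⊕ Fin 2) ℚ)))
      ≤ ({1, α, β, α * β} : Finset (Matrix (Fin 2 ⊕ Fin 2) (Fin 2 ⊕ Fin 2) ℚ)).card := by
        rw [show ({1, α, β, α * β} : Set (Matrix (Fin 2 ⊕ Fin 2) (Fin 2 ⊕ Fin 2) ℚ)) =
          (({1, α, β, α * β} : Finset (Matrix (Fin 2 ⊕ Fin 2) (Fin 2 ⊕ Fin 2) ℚ)) : Set _) by simp]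
        exact finrank_span_finset_le_card _
    _ ≤ 4 := Finset.card_le_four

/-! ## §2 The quaternionic basis `i = 2α − b`, `j = 2γ`, `k = ij` and the map `ℍ[ℚ, Δ, B² − ΔΔ′] → M₄(ℚ)` -/

/-- **The quaternionic basis of `ℚ(α, β)`**: `i = α₀ = 2R₀(q) − b·1` (`i² = Δ(q)`), `j = 2γ = 2(αβ − βα)`
(`j² = Δ(q,q′)² − Δ(q)Δ(q′) = −det S_Δ`), `k = ij = −ji` — a `QuaternionAlgebra.Basis` of `M₄(ℚ)` with parameters
`(Δ(q), 0, Δ(q,q′)² − Δ(q)Δ(q′))` (FILE 1: `humbertSqrt_mul_self`, `two_smul_humbertComm_mul_self`,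
`humbertSqrt_mul_two_smul_humbertComm`). [cite: Runge1999EndomorphismRingsAbelianSurfaces, §6 Thm. 7, proof (p. 295: "`γ² = (Δ(α, β)² − Δ(α)Δ(β))/4`")] -/
def humbertQuatBasis :
    QuaternionAlgebra.Basis (Matrix (Fin 2 ⊕ Fin 2) (Fin 2 ⊕ Fin 2) ℚ) ((humbertInvariant q : ℤ) : ℚ) 0
      ((humbertPolar q q' ^ 2 - humbertInvariant q * humbertInvariant q' : ℤ) : ℚ) where
  i := (humbertSqrt q).map (Int.cast : ℤ → ℚ)
  j := ((2 : ℤ) • humbertComm q q').map (Int.cast : ℤ → ℚ)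
  k := (humbertSqrt q).map (Int.cast : ℤ → ℚ) * ((2 : ℤ) • humbertComm q q').map (Int.cast : ℤ → ℚ)
  i_mul_i := by
    rw [zero_smul, add_zero, ← castQ_mul, humbertSqrt_mul_self, castQ_smul, castQ_one]
  j_mul_j := by
    rw [← castQ_mul, two_smul_humbertComm_mul_self, castQ_smul, castQ_one]
  i_mul_j := rfl
  j_mul_i := by
    have h := humbertSqrt_mul_two_smul_humbertComm q q'
    have h' : ((2 : ℤ) • humbertComm q q') * humbertSqrt q = -(humbertSqrt q * ((2 : ℤ) • humbertComm q q')) := by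
      rw [h, neg_neg]
    rw [zero_smul, zero_sub, ← castQ_mul, ← castQ_mul, h', castQ_neg]

/-- `i = 2α − b·1`. [cite: Runge1999EndomorphismRingsAbelianSurfaces, §6 p. 294 (`Δ(x) = t(x)² − 4n(x)`)] -/
theorem humbertQuatBasis_i : (humbertQuatBasis q q').i = (2 : ℚ) • α - (q 1 : ℚ) • (1 : Matrix _ _ ℚ) := by
  change (humbertSqrt q).map (Int.cast : ℤ → ℚ) = _
  rw [humbertSqrt_def, castQ_sub, castQ_smul, castQ_smul, castQ_one, Int.cast_ofNat]

/-- `j = 2(αβ − βα)`. [cite: Runge1999EndomorphismRingsAbelianSurfaces, §6 Thm. 7, proof (p. 295: "`γ = αβ − βα`")] -/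
theorem humbertQuatBasis_j : (humbertQuatBasis q q').j = (2 : ℚ) • (α * β - β * α) := by
  change ((2 : ℤ) • humbertComm q q').map (Int.cast : ℤ → ℚ) = _
  rw [castQ_smul, humbertComm_def, castQ_sub, castQ_mul, castQ_mul, Int.cast_ofNat]

/-- `k = ij`. [cite: Runge1999EndomorphismRingsAbelianSurfaces, §6 Thm. 7, proof (p. 295)] -/
theorem humbertQuatBasis_k : (humbertQuatBasis q q').k = (humbertQuatBasis q q').i * (humbertQuatBasis q q').j := rfl

/-- `i ∈ ℚ(α, β)`. [cite: Runge1999EndomorphismRingsAbelianSurfaces, §6 Lemma 8 (p. 295)] -/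
theorem humbertQuatBasis_i_mem : (humbertQuatBasis q q').i ∈ humbertPairAlg q q' := by
  rw [humbertQuatBasis_i]
  exact sub_mem (Subalgebra.smul_mem _ (humbertRatRep_map_mem_humbertPairAlg_left q q') _)
    (Subalgebra.smul_mem _ (one_mem _) _)

/-- `j ∈ ℚ(α, β)`. [cite: Runge1999EndomorphismRingsAbelianSurfaces, §6 Lemma 8 (p. 295)] -/
theorem humbertQuatBasis_j_mem : (humbertQuatBasis q q').j ∈ humbertPairAlg q q' := by
  rw [humbertQuatBasis_j]
  exact Subalgebra.smul_mem _ (sub_mem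
    (mul_mem (humbertRatRep_map_mem_humbertPairAlg_left q q') (humbertRatRep_map_mem_humbertPairAlg_right q q'))
    (mul_mem (humbertRatRep_map_mem_humbertPairAlg_right q q') (humbertRatRep_map_mem_humbertPairAlg_left q q'))) _

/-- `k ∈ ℚ(α, β)`. [cite: Runge1999EndomorphismRingsAbelianSurfaces, §6 Lemma 8 (p. 295)] -/
theorem humbertQuatBasis_k_mem : (humbertQuatBasis q q').k ∈ humbertPairAlg q q' :=
  mul_mem (humbertQuatBasis_i_mem q q') (humbertQuatBasis_j_mem q q')

/-- **The image of `ℍ[ℚ, Δ(q), Δ(q,q′)² − Δ(q)Δ(q′)] → M₄(ℚ)` lies in `ℚ(α, β)`** (always).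
[cite: Runge1999EndomorphismRingsAbelianSurfaces, §6 Thm. 7, proof (p. 295)] -/
theorem range_liftHom_humbertQuatBasis_le : (humbertQuatBasis q q').liftHom.range ≤ humbertPairAlg q q' := by
  rw [QuaternionAlgebra.Basis.range_liftHom, Algebra.adjoin_le_iff]
  rintro x (rfl | rfl | rfl)
  · exact humbertQuatBasis_i_mem q q'
  · exact humbertQuatBasis_j_mem q q'
  · exact humbertQuatBasis_k_mem q q'

/-- **`iβ₀ = Δ(q, q′)·1 + j`** (`β₀ = 2β − b′`): the product of the two square roots in the basis `(1, j)` (FILE 1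
`two_smul_humbertSqrt_mul`, halved over `ℚ`). [cite: Runge1999EndomorphismRingsAbelianSurfaces, §6 Lemma 8 (p. 295)] -/
theorem humbertQuatBasis_i_mul_humbertSqrt :
    (humbertQuatBasis q q').i * (humbertSqrt q').map (Int.cast : ℤ → ℚ) =
      ((humbertPolar q q' : ℤ) : ℚ) • (1 : Matrix _ _ ℚ) + (humbertQuatBasis q q').j := by
  have h := congrArg (fun A : Matrix (Fin 2 ⊕ Fin 2) (Fin 2 ⊕ Fin 2) ℤ ↦ A.map (Int.cast : ℤ → ℚ))
    (two_smul_humbertSqrt_mul q q')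
  simp only [castQ_add, castQ_mul, castQ_smul, castQ_one] at h
  change (humbertSqrt q).map (Int.cast : ℤ → ℚ) * _ = _ + ((2 : ℤ) • humbertComm q q').map (Int.cast : ℤ → ℚ)
  rw [castQ_smul]
  -- divide `2·(α₀β₀) = (2B)·1 + 4·γ` by `2`
  have h2 : (2 : ℚ) • ((humbertSqrt q).map (Int.cast : ℤ → ℚ) * (humbertSqrt q').map (Int.cast : ℤ → ℚ)) =
      (2 : ℚ) • (((humbertPolar q q' : ℤ) : ℚ) • (1 : Matrix (Fin 2 ⊕ Fin 2) (Fin 2 ⊕ Fin 2) ℚ) +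
        ((2 : ℤ) : ℚ) • (humbertComm q q').map (Int.cast : ℤ → ℚ)) := by
    rw [show ((2 : ℤ) : ℚ) = 2 by norm_num] at h ⊢
    rw [h]
    simp only [Int.cast_mul, Int.cast_ofNat, smul_add, smul_smul]
    norm_num
  exact smul_right_injective (Matrix (Fin 2 ⊕ Fin 2) (Fin 2 ⊕ Fin 2) ℚ) (two_ne_zero : (2 : ℚ) ≠ 0) h2

/-- For `Δ(q) ≠ 0`, the second square root `β₀ = 2β − b′` lies in the algebra generated by `i, j, k`:
`β₀ = Δ(q)⁻¹ · i (Δ(q,q′)·1 + j)`. [cite: Runge1999EndomorphismRingsAbelianSurfaces, §6 Thm. 7, proof (p. 295)] -/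
theorem humbertSqrt_map_mem_range_liftHom (hΔ : humbertInvariant q ≠ 0) :
    (humbertSqrt q').map (Int.cast : ℤ → ℚ) ∈ (humbertQuatBasis q q').liftHom.range := by
  set Bq := humbertQuatBasis q q'
  have hi : Bq.i ∈ Bq.liftHom.range := by
    rw [QuaternionAlgebra.Basis.range_liftHom]; exact Algebra.subset_adjoin (by simp)
  have hj : Bq.j ∈ Bq.liftHom.range := by
    rw [QuaternionAlgebra.Basis.range_liftHom]; exact Algebra.subset_adjoin (by simp)
  have hii : Bq.i * Bq.i = ((humbertInvariant q : ℤ) : ℚ) • (1 : Matrix _ _ ℚ) := by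
    rw [Bq.i_mul_i, zero_smul, add_zero]
  have hΔQ : ((humbertInvariant q : ℤ) : ℚ) ≠ 0 := by exact_mod_cast hΔ
  -- `i (i β₀) = Δ β₀`
  have hkey : (humbertSqrt q').map (Int.cast : ℤ → ℚ) =
      ((humbertInvariant q : ℤ) : ℚ)⁻¹ • (Bq.i * (((humbertPolar q q' : ℤ) : ℚ) • (1 : Matrix _ _ ℚ) + Bq.j)) := by
    rw [← humbertQuatBasis_i_mul_humbertSqrt, ← mul_assoc, hii, smul_mul_assoc, one_mul, smul_smul,
      inv_mul_cancel₀ hΔQ, one_smul]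
  rw [hkey]
  exact Subalgebra.smul_mem _ (mul_mem hi (add_mem (Subalgebra.smul_mem _ (one_mem _) _) hj)) _

/-- **For `Δ(q) ≠ 0` the image of `ℍ[ℚ, Δ(q), Δ(q,q′)² − Δ(q)Δ(q′)]` is exactly `ℚ(α, β)`** (`α = ½(i + b)`,
`β = ½(β₀ + b′)` with `β₀ = Δ⁻¹ i (B + j)`). [cite: Runge1999EndomorphismRingsAbelianSurfaces, §6 Thm. 7, proof (p. 295)] -/
theorem range_liftHom_humbertQuatBasis (hΔ : humbertInvariant q ≠ 0) :
    (humbertQuatBasis q q').liftHom.range = humbertPairAlg q q' := by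
  refine le_antisymm (range_liftHom_humbertQuatBasis_le q q') ?_
  set Bq := humbertQuatBasis q q'
  have hi : Bq.i ∈ Bq.liftHom.range := by
    rw [QuaternionAlgebra.Basis.range_liftHom]; exact Algebra.subset_adjoin (by simp)
  -- `α = ½ (i + b·1)`, `β = ½ (β₀ + b′·1)`
  have hα : α = (2 : ℚ)⁻¹ • (Bq.i + (q 1 : ℚ) • (1 : Matrix _ _ ℚ)) := by
    rw [humbertQuatBasis_i, sub_add_cancel, smul_smul, inv_mul_cancel₀ two_ne_zero, one_smul]
  have hβ : β = (2 : ℚ)⁻¹ • ((humbertSqrt q').map (Int.cast : ℤ → ℚ) + (q' 1 : ℚ) • (1 : Matrix _ _ ℚ)) := by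
    rw [humbertSqrt_def, castQ_sub, castQ_smul, castQ_smul, castQ_one, Int.cast_ofNat, sub_add_cancel, smul_smul,
      inv_mul_cancel₀ two_ne_zero, one_smul]
  rw [humbertPairAlg, Algebra.adjoin_le_iff]
  rintro x (rfl | rfl)
  · rw [hα]
    exact Subalgebra.smul_mem _ (add_mem hi (Subalgebra.smul_mem _ (one_mem _) _)) _
  · rw [hβ]
    exact Subalgebra.smul_mem _ (add_mem (humbertSqrt_map_mem_range_liftHom q q' hΔ)
      (Subalgebra.smul_mem _ (one_mem _) _)) _

/-! ## §3 `ℚ(α, β)` is a quaternion algebra when `Δ(q) ≠ 0` and `det S_Δ ≠ 0` -/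

/-- **The algebra map `ℍ[ℚ, Δ(q), Δ(q,q′)² − Δ(q)Δ(q′)] → M₄(ℚ)` is injective** when `Δ(q) ≠ 0` and
`det S_Δ = Δ(q)Δ(q′) − Δ(q,q′)² ≠ 0` (a non-zero algebra map out of a central simple algebra: the tree's
`QuaternionAlgebra.isSimpleRing`). [cite: Runge1999EndomorphismRingsAbelianSurfaces, §6 Lemma 8 and Thm. 7 (p. 295)] [cite: VignerasLNM800, Ch. I §1 p. 2] -/
theorem humbertQuatBasis_liftHom_injective (hΔ : humbertInvariant q ≠ 0)
    (hS : humbertInvariant q * humbertInvariant q' ≠ humbertPolar q q' ^ 2) :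
    Injective (humbertQuatBasis q q').liftHom := by
  have hΔQ : ((humbertInvariant q : ℤ) : ℚ) ≠ 0 := by exact_mod_cast hΔ
  have hSQ : ((humbertPolar q q' ^ 2 - humbertInvariant q * humbertInvariant q' : ℤ) : ℚ) ≠ 0 := by
    have : humbertPolar q q' ^ 2 - humbertInvariant q * humbertInvariant q' ≠ 0 := sub_ne_zero.2 (Ne.symm hS)
    exact_mod_cast this
  haveI := QuaternionAlgebra.isSimpleRing hΔQ hSQ
  exact RingHom.injective (humbertQuatBasis q q').liftHom.toRingHom

/-- **"`ℚ(α, β)` is a quaternion algebra": `ℍ[ℚ, Δ(q), Δ(q,q′)² − Δ(q)Δ(q′)] ≃ₐ[ℚ] ℚ(α, β)`** for `Δ(q) ≠ 0`,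
`det S_Δ ≠ 0`, sending `i ↦ 2α − b`, `j ↦ 2(αβ − βα)`. [cite: Runge1999EndomorphismRingsAbelianSurfaces, §6 Lemma 8 and Thm. 7 (p. 295)] -/
def humbertPairAlgEquiv (hΔ : humbertInvariant q ≠ 0)
    (hS : humbertInvariant q * humbertInvariant q' ≠ humbertPolar q q' ^ 2) :
    ℍ[ℚ, ((humbertInvariant q : ℤ) : ℚ), ((humbertPolar q q' ^ 2 - humbertInvariant q * humbertInvariant q' : ℤ) : ℚ)]
      ≃ₐ[ℚ] humbertPairAlg q q' :=
  (AlgEquiv.ofInjective _ (humbertQuatBasis_liftHom_injective q q' hΔ hS)).trans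
    (Subalgebra.equivOfEq _ _ (range_liftHom_humbertQuatBasis q q' hΔ))

/-- The equivalence on elements: `x ↦ x₀·1 + x₁ i + x₂ j + x₃ k`. [cite: Runge1999EndomorphismRingsAbelianSurfaces, §6 Thm. 7, proof (p. 295)] -/
theorem coe_humbertPairAlgEquiv_apply (hΔ : humbertInvariant q ≠ 0)
    (hS : humbertInvariant q * humbertInvariant q' ≠ humbertPolar q q' ^ 2)
    (x : ℍ[ℚ, ((humbertInvariant q : ℤ) : ℚ), ((humbertPolar q q' ^ 2 - humbertInvariant q * humbertInvariant q' : ℤ) : ℚ)]) :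
    (humbertPairAlgEquiv q q' hΔ hS x : Matrix (Fin 2 ⊕ Fin 2) (Fin 2 ⊕ Fin 2) ℚ) = (humbertQuatBasis q q').liftHom x :=
  rfl

/-- **`dim_ℚ ℚ(α, β) = 4`** for `Δ(q) ≠ 0`, `det S_Δ ≠ 0`. [cite: Runge1999EndomorphismRingsAbelianSurfaces, §6 Thm. 7, proof (p. 295: "`R ⊗ ℚ = ℚ ⊕ ℚα ⊕ ℚβ ⊕ ℚαβ`")] -/
theorem finrank_humbertPairAlg (hΔ : humbertInvariant q ≠ 0)
    (hS : humbertInvariant q * humbertInvariant q' ≠ humbertPolar q q' ^ 2) :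
    finrank ℚ (humbertPairAlg q q') = 4 := by
  rw [← (humbertPairAlgEquiv q q' hΔ hS).toLinearEquiv.finrank_eq, QuaternionAlgebra.finrank_eq_four]

/-- **`ℚ(α, β)` is a quaternion algebra over `ℚ`** — central, simple, four-dimensional (the tree's
`IsQuaternionAlgebra`), for `Δ(q) ≠ 0` and `det S_Δ ≠ 0`: RUNGE'S LEMMA 8, second sentence, in the form used by his
Theorem 7. [cite: Runge1999EndomorphismRingsAbelianSurfaces, §6 Lemma 8 and Thm. 7 (p. 295)] [cite: VignerasLNM800, Ch. I §1 p. 2] -/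
theorem isQuaternionAlgebra_humbertPairAlg (hΔ : humbertInvariant q ≠ 0)
    (hS : humbertInvariant q * humbertInvariant q' ≠ humbertPolar q q' ^ 2) :
    IsQuaternionAlgebra ℚ (humbertPairAlg q q') := by
  have hΔQ : ((humbertInvariant q : ℤ) : ℚ) ≠ 0 := by exact_mod_cast hΔ
  have hSQ : ((humbertPolar q q' ^ 2 - humbertInvariant q * humbertInvariant q' : ℤ) : ℚ) ≠ 0 := by
    have : humbertPolar q q' ^ 2 - humbertInvariant q * humbertInvariant q' ≠ 0 := sub_ne_zero.2 (Ne.symm hS)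
    exact_mod_cast this
  have hH := QuaternionAlgebra.isQuaternionAlgebra_holds (K := ℚ) hΔQ hSQ
  set e := humbertPairAlgEquiv q q' hΔ hS
  haveI : Algebra.IsCentral ℚ (humbertPairAlg q q') := Algebra.IsCentral.of_algEquiv ℚ _ _ e
  exact { isSimpleRing := IsSimpleRing.of_ringEquiv e.toRingEquiv hH.isSimpleRing
          finrank_eq_four := finrank_humbertPairAlg q q' hΔ hS }

/-- **Independence half of "`R ⊗ ℚ = ℚ ⊕ ℚα ⊕ ℚβ ⊕ ℚαβ`": `1, α, β, αβ` are linearly independent over `ℚ`** when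
`Δ(q) ≠ 0` and `det S_Δ ≠ 0` (four elements spanning a four-dimensional space).
[cite: Runge1999EndomorphismRingsAbelianSurfaces, §6 Thm. 7, proof (p. 295)] -/
theorem linearIndependent_one_humbertRatRep_pair (hΔ : humbertInvariant q ≠ 0)
    (hS : humbertInvariant q * humbertInvariant q' ≠ humbertPolar q q' ^ 2) :
    LinearIndependent ℚ ![(1 : Matrix (Fin 2 ⊕ Fin 2) (Fin 2 ⊕ Fin 2) ℚ), α, β, α * β] := by
  rw [linearIndependent_iff_card_eq_finrank_span, Fintype.card_fin]
  have hrange : Set.range ![(1 : Matrix (Fin 2 ⊕ Fin 2) (Fin 2 ⊕ Fin 2) ℚ), α, β, α * β] = {1, α, β, α * β} := by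
    ext x
    simp only [Set.mem_range, Set.mem_insert_iff, Set.mem_singleton_iff]
    constructor
    · rintro ⟨i, rfl⟩; fin_cases i <;> simp
    · rintro (rfl | rfl | rfl | rfl)
      · exact ⟨0, rfl⟩
      · exact ⟨1, rfl⟩
      · exact ⟨2, rfl⟩
      · exact ⟨3, rfl⟩
  have h4 := finrank_humbertPairAlg q q' hΔ hS
  rw [← Subalgebra.finrank_toSubmodule, humbertPairAlg_toSubmodule_eq_span, ← hrange] at h4
  exact h4.symm

/-- **`αβ = βα ⟺ γ = 0`, and then `det S_Δ = 0`**: if the discriminant matrix is non-degenerate the two symmetric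
endomorphisms do NOT commute — `ℚ(α, β)` is non-commutative. [cite: Runge1999EndomorphismRingsAbelianSurfaces, §6 Thm. 7, proof (p. 295)] -/
theorem humbertRatRep_map_mul_ne (hS : humbertInvariant q * humbertInvariant q' ≠ humbertPolar q q' ^ 2) :
    α * β ≠ β * α := by
  intro h
  have hγ : humbertComm q q' = 0 := by
    apply castQ_injective
    change (humbertComm q q').map (Int.cast : ℤ → ℚ) = (0 : Matrix _ _ ℤ).map (Int.cast : ℤ → ℚ)
    rw [humbertComm_def, castQ_sub, castQ_mul, castQ_mul, h, sub_self, castQ_zero]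
  exact hS (humbertPolar_sq_eq_of_humbertComm_eq_zero hγ).symm

/-- Hence `ℚ(α, β)` is not commutative for `det S_Δ ≠ 0`. [cite: Runge1999EndomorphismRingsAbelianSurfaces, §6 Thm. 7, proof (p. 295)] -/
theorem exists_mul_ne_of_humbertPairAlg (hS : humbertInvariant q * humbertInvariant q' ≠ humbertPolar q q' ^ 2) :
    ∃ x ∈ humbertPairAlg q q', ∃ y ∈ humbertPairAlg q q', x * y ≠ y * x :=
  ⟨α, humbertRatRep_map_mem_humbertPairAlg_left q q', β, humbertRatRep_map_mem_humbertPairAlg_right q q',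
    humbertRatRep_map_mul_ne q q' hS⟩

/-! ## §4 The admissibility sign: `(Δ(q), c)_ℝ ≅ M₂(ℝ)` for `Δ(q) > 0` (indefiniteness) -/

/-- **The quaternion algebra of a pair of relations is INDEFINITE**: for `Δ(q) > 0` (every relation with a solution in
`𝔥₂` has positive invariant, row A4-59) and any `c ≠ 0`, `ℍ[ℝ, Δ(q), c] ≅ M₂(ℝ)` — because `c = x² − Δ(q)y²` is
solvable in `ℝ` (the tree's `QuaternionAlgebra.nonempty_algEquiv_matrix_iff`, Vignéras I Cor. 2.4). Runge's
admissibility condition "`γ² = (Δ(α,β)² − Δ(α)Δ(β))/4` is a negative number" is the DEFINITENESS of `S_Δ`, not a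
condition at the real place. [cite: Runge1999EndomorphismRingsAbelianSurfaces, §6 Thm. 7, proof (p. 295)] [cite: VignerasLNM800, Ch. I §2 Cor. 2.4] -/
theorem nonempty_algEquiv_real_matrix_of_humbertInvariant_pos (hΔ : 0 < humbertInvariant q) {c : ℝ} (hc : c ≠ 0) :
    Nonempty (ℍ[ℝ, ((humbertInvariant q : ℤ) : ℝ), c] ≃ₐ[ℝ] Matrix (Fin 2) (Fin 2) ℝ) := by
  have hΔR : (0 : ℝ) < ((humbertInvariant q : ℤ) : ℝ) := by exact_mod_cast hΔ
  rw [QuaternionAlgebra.nonempty_algEquiv_matrix_iff hΔR.ne' hc]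
  -- `x² − Δ y² = c` with `y = t`, `x = √(c + Δ t²)` for `t` large
  set Δ : ℝ := ((humbertInvariant q : ℤ) : ℝ)
  set t : ℝ := |c| / Δ + 1
  have ht1 : 1 ≤ t := by
    have : 0 ≤ |c| / Δ := div_nonneg (abs_nonneg c) hΔR.le
    linarith
  have hnonneg : 0 ≤ c + Δ * t ^ 2 := by
    have h1 : Δ * t ≤ Δ * t ^ 2 := by
      have : t ≤ t ^ 2 := by nlinarith
      exact mul_le_mul_of_nonneg_left this hΔR.le
    have h2 : Δ * t = |c| + Δ := by
      simp only [t]; field_simp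
    have h3 : -c ≤ |c| := neg_le_abs c
    nlinarith
  refine ⟨Real.sqrt (c + Δ * t ^ 2), t, ?_⟩
  rw [Real.sq_sqrt hnonneg]
  ring

end PairAlgebra

end SiegelModuli

end Literature.AlgebraicGeometry.ModuliOfAbelianVarieties
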